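import Summits.ABC.IUTFork.LDHGenuinePerImageAllLevels
import HarnessLib

/-!
# The fork at [IUTchIII] Corollary 3.12, L-DH level, READING (P): the per-image Corollary AS TYPED at EVERY PRIME LEVEL `l ≥ 5`
# for `1 + 3¹⁶·7 = 2³·11·23·53³`, and the level `l = 5` of `283 + 5¹¹·13²` and `2 + 3¹⁰·109 = 23⁵` (abc-iut cell, branch C, row
# «C:PERIMAGE-P-ALL-LEVELS», file 3 of 3)

Record-only PROOF file (D-0012) of the abc-iut cell (branch-C certificate seat abc-iut-C-cert-2, gen 6; crux ThetaPartII =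
stmt-ABC-19678). TAKES NO SIDE on [IUTchIII] Cor. 3.12 or on any author. File 1 (`LDHGenuinePerImageAllLevels`, p495862) proved the
closed form `cor312PerImageOf_ratPoint_sharp_closedForm` of abc-iut-c312-d1's sharpened rational-point test (p484321), uniform in the
level `l` and covering `l ∈ I`, its monotonicity `weights_mono_seven`, and `Frey283.cor312PerImageOf_all` / `Reyssat.cor312PerImageOf_all`
(every prime `l ≥ 7`). HERE: (1) the third tabulated triple without a uniform theorem, **`Frey301327048.cor312PerImageOf_all`**
(`λ = 1/301327048`; every prime `l ≥ 7`: ONE certificate at `l = 7` + `weights_mono_seven` off `I`, the pole levels `7, 11, 53` by the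
closed form, `23` = abc-iut-c312-d1's primed unconditional level BY NAME); (2) the level `l = 5` of this triple, of `283 + 5¹¹·13²` and of
the Reyssat triple by abc-iut-c312-d1's `(1 − 1/l)`-weighted rational test `cor312PerImageOf_ratPoint_of_le` (`LDHGenuinePerImageUnconditional`,
valid from `l = 5`; the sharpened test starts at `l = 7`), and the assemblies **`Frey301327048.cor312PerImageOf_every`**,
**`Frey283.cor312PerImageOf_every`**, **`Reyssat.cor312PerImageOf_every`**: `T.Cor312PerImageOf` at EVERY genuine Θ-datum for EVERY
prime `l ≥ 5` — the full `l`-range of the books' binders (`l.Prime → 5 ≤ l`) — NO hypothesis. The pole dictionaries of file 1 are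
private there and re-derived here (a few `norm_num` lines). Certificates ≤ 11 digits (seat folder `gen_certs.py` / `gen_alllevels.py`).

READING (neutral; branch-C books): positive reading-(P) instances (`hNumPOffBad` of p462946 and its M twin have a TRUE conclusion)
on the whole prime `l`-axis `l ≥ 7` at these `λ`, next to ruling C-R80's (U) instances; no certificate's hypothesis count moves.
HONEST SCOPE: OUR typed per-image inequality, (Ind2) = the cell's full lattice-automorphism typing (Dupuy–Hilado §4.9); nothing about
print's (Ind2) or the printed inequality; nothing asserts that genuine data exist at any `(λ, l)`, Cor. 3.12 in general, or abc;
proved-as-typed ≠ in print; typed ≠ proved. [cite: Mochizuki2012, IUTchIII Cor. 3.12 p. 173–174, proof Step (x) p. 181; IUTchIV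
Thm. 1.10 p. 22–24, Step (v) p. 27–29, Cor. 2.2 (ii) proof (P5) p. 46] [cite: SilvermanAEC2009, Prop. III.1.7(b)]
[cite: DupuyHilado2025, §4.9, §4.12] [claim: Mochizuki2012, status: disputed] for every IUT quotation. PROOF-ONLY: no definitions,
no new `Prop`.
-/

noncomputable section

namespace Literature.IUT.LogVolume.Cor22

open NumberField IsDedekindDomain Ideal Module Literature.NumberTheory.DiophantineGeometry
open Literature.NumberTheory.DiophantineGeometry.GenEll Summit.ABC.IUTFork Literature.IUT.HodgeTheaters

/-! ### `1 + 3¹⁶·7 = 2³·11·23·53³` (`λ = 1/ 301327048`; `I = {3, 7, 11, 23, 53}`, `c = 5`) -/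

namespace Frey301327048

/-- The primes of the reduced denominator of `j(λ)`. [folklore] -/
private theorem primes : ∀ p ∈ ({3, 7, 11, 23, 53} : Finset ℕ), p.Prime := by
  intro p hp
  simp only [Finset.mem_insert, Finset.mem_singleton] at hp
  rcases hp with rfl | rfl | rfl | rfl | rfl <;> norm_num

/-- The exponents are positive. [folklore] -/
private theorem exp_ne_zero : ∀ p ∈ ({3, 7, 11, 23, 53} : Finset ℕ), (fun p => if p = 3 then 32 else if p = 7 then 2 else if p = 11 then 2 else if p = 23 then 2 else 6) p ≠ 0 := by
  intro p hp
  simp only [Finset.mem_insert, Finset.mem_singleton] at hp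
  rcases hp with rfl | rfl | rfl | rfl | rfl <;> norm_num

/-- The factorised denominator. [folklore] -/
private theorem den : (128816795425657851831187916927649 : ℕ) = ∏ p ∈ ({3, 7, 11, 23, 53} : Finset ℕ), p ^ (fun p => if p = 3 then 32 else if p = 7 then 2 else if p = 11 then 2 else if p = 23 then 2 else 6) p := by
  rw [Finset.prod_insert (by decide), Finset.prod_insert (by decide), Finset.prod_insert (by decide), Finset.prod_insert (by decide), Finset.prod_singleton]
  norm_num

/-- The numerator is prime to every prime of the denominator. [folklore] -/
private theorem coprime : ∀ p ∈ ({3, 7, 11, 23, 53} : Finset ℕ), ¬ p ∣ (2994254347667486079594360941029171127543447587294372 : ℕ) := by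
  intro p hp
  simp only [Finset.mem_insert, Finset.mem_singleton] at hp
  rcases hp with rfl | rfl | rfl | rfl | rfl <;> norm_num

/-- The constant `c = 5` is below every `lcm(30/gcd(30,e_p), c_p)`, `p` odd. [folklore] -/
private theorem c_le : ∀ p ∈ ({3, 7, 11, 23, 53} : Finset ℕ), p ≠ 2 →
    5 ≤ Nat.lcm (30 / Nat.gcd 30 ((fun p => if p = 3 then 32 else if p = 7 then 2 else if p = 11 then 2 else if p = 23 then 2 else 6) p)) (if p = 3 then 2 else if p = 5 then 4 else 1) := by
  intro p hp
  simp only [Finset.mem_insert, Finset.mem_singleton] at hp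
  rcases hp with rfl | rfl | rfl | rfl | rfl <;> decide

/-- `Q = Σ_{p odd} e_p·log p`. [folklore] -/
private theorem sumQ : ∑ p ∈ ({3, 7, 11, 23, 53} : Finset ℕ).erase 2, (((fun p => if p = 3 then 32 else if p = 7 then 2 else if p = 11 then 2 else if p = 23 then 2 else 6) p : ℕ) : ℝ) * Real.log p = 32 * Real.log 3 + 2 * Real.log 7 + 2 * Real.log 11 + 2 * Real.log 23 + 6 * Real.log 53 := by
  rw [show ({3, 7, 11, 23, 53} : Finset ℕ).erase 2 = ({3, 7, 11, 23, 53} : Finset ℕ) by decide, Finset.sum_insert (by decide), Finset.sum_insert (by decide), Finset.sum_insert (by decide), Finset.sum_insert (by decide), Finset.sum_singleton]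
  norm_num
  ring

/-- `R = Σ_{p odd} log p`. [folklore] -/
private theorem sumR : ∑ p ∈ ({3, 7, 11, 23, 53} : Finset ℕ).erase 2, Real.log p = Real.log 3 + Real.log 7 + Real.log 11 + Real.log 23 + Real.log 53 := by
  rw [show ({3, 7, 11, 23, 53} : Finset ℕ).erase 2 = ({3, 7, 11, 23, 53} : Finset ℕ) by decide, Finset.sum_insert (by decide), Finset.sum_insert (by decide), Finset.sum_insert (by decide), Finset.sum_insert (by decide), Finset.sum_singleton]
  push_cast
  ring

/-- **Level `l = 7`** (`l ∈ I`): `T.Cor312PerImageOf` at every genuine Θ-datum of `1 + 3¹⁶·7 = 2³·11·23·53³` — NO hypothesis; closed form,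
certificate `3^14·53 ≤ 2^2·5^3·7^3·11^2·23^2`, `π > 3` (margin ≈ 2.95 nats). [cite: Mochizuki2012, IUTchIII Cor. 3.12 p. 173–174] [claim: Mochizuki2012, status: disputed] -/
theorem cor312PerImageOf_seven (T : ThetaVolumeDatumAt (ratPoint ((1 : ℚ) / 301327048)) 7) : T.Cor312PerImageOf := by
  have hpi : Real.log 3 < Real.log Real.pi := Real.log_lt_log (by norm_num) Real.pi_gt_three
  have hp2 : 0 < Real.log 2 := Real.log_pos (by norm_num); have hp3 : 0 < Real.log 3 := Real.log_pos (by norm_num); have hp5 : 0 < Real.log 5 := Real.log_pos (by norm_num); have hp7 : 0 < Real.log 7 := Real.log_pos (by norm_num); have hp11 : 0 < Real.log 11 := Real.log_pos (by norm_num); have hp23 : 0 < Real.log 23 := Real.log_pos (by norm_num); have hp53 : 0 < Real.log 53 := Real.log_pos (by norm_num)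
  refine cor312PerImageOf_ratPoint_sharp_closedForm (q := (1 : ℚ) / 301327048) (by norm_num) (by norm_num) (by norm_num) (by norm_num)
    primes exp_ne_zero den jInv_freyC (by norm_num) coprime (le_of_eq sumQ) (le_of_eq sumR.symm) 5 (by norm_num) c_le ?_ T
  have hZ : (3 ^ 14 * 53 : ℕ) ≤ 2 ^ 2 * 5 ^ 3 * 7 ^ 3 * 11 ^ 2 * 23 ^ 2 := by norm_num
  have hR : ((3 : ℝ) ^ 14 * (53 : ℝ)) ≤ (2 : ℝ) ^ 2 * (5 : ℝ) ^ 3 * (7 : ℝ) ^ 3 * (11 : ℝ) ^ 2 * (23 : ℝ) ^ 2 := by exact_mod_cast hZ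
  have hlog := Real.log_le_log (by positivity) hR
  repeat rw [Real.log_mul (by positivity) (by positivity)] at hlog
  simp only [Real.log_pow] at hlog; push_cast at hlog ⊢; norm_num
  linarith [hlog, hpi, hp2, hp3, hp5, hp7, hp11, hp23, hp53]

/-- **Level `l = 11`** (`l ∈ I`): `T.Cor312PerImageOf` at every genuine Θ-datum of `1 + 3¹⁶·7 = 2³·11·23·53³` — NO hypothesis; closed form,
certificate `3^14·53 ≤ 2^2·5^3·7^2·11^3·23^2`, `π > 3` (margin ≈ 3.30 nats). [cite: Mochizuki2012, IUTchIII Cor. 3.12 p. 173–174] [claim: Mochizuki2012, status: disputed] -/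
theorem cor312PerImageOf_eleven (T : ThetaVolumeDatumAt (ratPoint ((1 : ℚ) / 301327048)) 11) : T.Cor312PerImageOf := by
  have hpi : Real.log 3 < Real.log Real.pi := Real.log_lt_log (by norm_num) Real.pi_gt_three
  have hp2 : 0 < Real.log 2 := Real.log_pos (by norm_num); have hp3 : 0 < Real.log 3 := Real.log_pos (by norm_num); have hp5 : 0 < Real.log 5 := Real.log_pos (by norm_num); have hp7 : 0 < Real.log 7 := Real.log_pos (by norm_num); have hp11 : 0 < Real.log 11 := Real.log_pos (by norm_num); have hp23 : 0 < Real.log 23 := Real.log_pos (by norm_num); have hp53 : 0 < Real.log 53 := Real.log_pos (by norm_num)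
  refine cor312PerImageOf_ratPoint_sharp_closedForm (q := (1 : ℚ) / 301327048) (by norm_num) (by norm_num) (by norm_num) (by norm_num)
    primes exp_ne_zero den jInv_freyC (by norm_num) coprime (le_of_eq sumQ) (le_of_eq sumR.symm) 5 (by norm_num) c_le ?_ T
  have hZ : (3 ^ 14 * 53 : ℕ) ≤ 2 ^ 2 * 5 ^ 3 * 7 ^ 2 * 11 ^ 3 * 23 ^ 2 := by norm_num
  have hR : ((3 : ℝ) ^ 14 * (53 : ℝ)) ≤ (2 : ℝ) ^ 2 * (5 : ℝ) ^ 3 * (7 : ℝ) ^ 2 * (11 : ℝ) ^ 3 * (23 : ℝ) ^ 2 := by exact_mod_cast hZ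
  have hlog := Real.log_le_log (by positivity) hR
  repeat rw [Real.log_mul (by positivity) (by positivity)] at hlog
  simp only [Real.log_pow] at hlog; push_cast at hlog ⊢; norm_num
  linarith [hlog, hpi, hp2, hp3, hp5, hp7, hp11, hp23, hp53]

/-- **Level `l = 53`** (`l ∈ I`): `T.Cor312PerImageOf` at every genuine Θ-datum of `1 + 3¹⁶·7 = 2³·11·23·53³` — NO hypothesis; closed form,
certificate `3^7 ≤ 2·5·7·11·23·53`, `π > 3` (margin ≈ 6.79 nats). [cite: Mochizuki2012, IUTchIII Cor. 3.12 p. 173–174] [claim: Mochizuki2012, status: disputed] -/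
theorem cor312PerImageOf_fiftythree (T : ThetaVolumeDatumAt (ratPoint ((1 : ℚ) / 301327048)) 53) : T.Cor312PerImageOf := by
  have hpi : Real.log 3 < Real.log Real.pi := Real.log_lt_log (by norm_num) Real.pi_gt_three
  have hp2 : 0 < Real.log 2 := Real.log_pos (by norm_num); have hp3 : 0 < Real.log 3 := Real.log_pos (by norm_num); have hp5 : 0 < Real.log 5 := Real.log_pos (by norm_num); have hp7 : 0 < Real.log 7 := Real.log_pos (by norm_num); have hp11 : 0 < Real.log 11 := Real.log_pos (by norm_num); have hp23 : 0 < Real.log 23 := Real.log_pos (by norm_num); have hp53 : 0 < Real.log 53 := Real.log_pos (by norm_num)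
  refine cor312PerImageOf_ratPoint_sharp_closedForm (q := (1 : ℚ) / 301327048) (by norm_num) (by norm_num) (by norm_num) (by norm_num)
    primes exp_ne_zero den jInv_freyC (by norm_num) coprime (le_of_eq sumQ) (le_of_eq sumR.symm) 5 (by norm_num) c_le ?_ T
  have hZ : (3 ^ 7 : ℕ) ≤ 2 * 5 * 7 * 11 * 23 * 53 := by norm_num
  have hR : ((3 : ℝ) ^ 7) ≤ (2 : ℝ) * (5 : ℝ) * (7 : ℝ) * (11 : ℝ) * (23 : ℝ) * (53 : ℝ) := by exact_mod_cast hZ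
  have hlog := Real.log_le_log (by positivity) hR
  repeat rw [Real.log_mul (by positivity) (by positivity)] at hlog
  simp only [Real.log_pow] at hlog; push_cast at hlog ⊢; norm_num
  linarith [hlog, hpi, hp2, hp3, hp5, hp7, hp11, hp23, hp53]

/-- **[IUTchIII] COR. 3.12 IN READING (P), AS TYPED, HOLDS AT EVERY GENUINE Θ-DATUM OF `1 + 3¹⁶·7 = 2³·11·23·53³` AT EVERY PRIME LEVEL
`l ≥ 7`** — no hypothesis. Off `I`: the closed form of §1 at `l = 7` (one certificate, `π > 3`) and `weights_mono_seven`;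
`l = 7`, `l = 11`, `l = 53`: the closed form at the level; `l = 23`: the landed unconditional levels BY NAME.
[cite: Mochizuki2012, IUTchIII Cor. 3.12 p. 173–174; IUTchIV Thm. 1.10 Step (v) p. 27–29] [claim: Mochizuki2012, status: disputed] -/
theorem cor312PerImageOf_all {l : ℕ} (hl : l.Prime) (h7 : 7 ≤ l)
    (T : ThetaVolumeDatumAt (ratPoint ((1 : ℚ) / 301327048)) l) : T.Cor312PerImageOf := by
  by_cases hlI : l ∈ ({3, 7, 11, 23, 53} : Finset ℕ)
  · have hlI' := hlI
    simp only [Finset.mem_insert, Finset.mem_singleton] at hlI'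
    rcases hlI' with rfl | rfl | rfl | rfl | rfl
    · omega
    · exact cor312PerImageOf_seven T
    · exact cor312PerImageOf_eleven T
    · exact cor312PerImageOf_freyC_twentythree' T
    · exact cor312PerImageOf_fiftythree T
  · -- `l ∉ I`: the closed form at `l = 7` (margin ≈ 4.19 nats) and monotonicity in `l`
    have hpi : Real.log 3 < Real.log Real.pi := Real.log_lt_log (by norm_num) Real.pi_gt_three
    have hp2 : 0 < Real.log 2 := Real.log_pos (by norm_num); have hp3 : 0 < Real.log 3 := Real.log_pos (by norm_num); have hp5 : 0 < Real.log 5 := Real.log_pos (by norm_num); have hp7 : 0 < Real.log 7 := Real.log_pos (by norm_num); have hp11 : 0 < Real.log 11 := Real.log_pos (by norm_num); have hp23 : 0 < Real.log 23 := Real.log_pos (by norm_num); have hp53 : 0 < Real.log 53 := Real.log_pos (by norm_num)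
    refine cor312PerImageOf_ratPoint_sharp_closedForm (q := (1 : ℚ) / 301327048) (by norm_num) (by norm_num) hl h7
      primes exp_ne_zero den jInv_freyC (by norm_num) coprime (le_of_eq sumQ) (le_of_eq sumR.symm) 5 (by norm_num) c_le ?_ T
    rw [if_neg hlI, if_neg hlI]
    simp only [sub_zero]
    have h3I : (3 : ℕ) ∈ ({3, 7, 11, 23, 53} : Finset ℕ) := by decide
    have h5I : (5 : ℕ) ∉ ({3, 7, 11, 23, 53} : Finset ℕ) := by decide
    rw [if_pos h3I, if_neg h5I]
    have hmono := weights_mono_seven h7 (c := (5 : ℝ)) (by norm_num)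
      (R := Real.log 3 + Real.log 7 + Real.log 11 + Real.log 23 + Real.log 53) (by positivity)
    have hZ : (3 ^ 7 * 53 : ℕ) ≤ 2 * 5 * 7 ^ 2 * 11 * 23 := by norm_num
    have hR : ((3 : ℝ) ^ 7 * (53 : ℝ)) ≤ (2 : ℝ) * (5 : ℝ) * (7 : ℝ) ^ 2 * (11 : ℝ) * (23 : ℝ) := by exact_mod_cast hZ
    have hlog := Real.log_le_log (by positivity) hR
    repeat rw [Real.log_mul (by positivity) (by positivity)] at hlog
    simp only [Real.log_pow] at hlog; push_cast at hlog hmono ⊢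
    linarith [hlog, hpi, hmono, hp2, hp3, hp5, hp7, hp11, hp23, hp53]

/-- `log q^{∤{2,5}}(λ)` exactly. [cite: Mochizuki2012, IUTchIV Thm 1.10 p.23] [claim: Mochizuki2012, status: disputed] -/
theorem logQAvoid_five : logQAvoid (ratPoint ((1 : ℚ) / 301327048)) {2, 5} = 32 * Real.log 3 + 2 * Real.log 7 + 2 * Real.log 11 + 2 * Real.log 23 + 6 * Real.log 53 := by
  have h := logQAvoid_ratPoint_eq_sum primes exp_ne_zero den jInv_freyC (by norm_num) {2, 5} (fun p hp _ => coprime p hp)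
  rw [Finset.sum_filter] at h
  norm_num [Finset.sum_insert] at h
  linarith [h]

/-- `log 𝔣^{∤{2,5}}(λ)` exactly. [cite: Mochizuki2012, IUTchIV Thm 1.10 p.23] [claim: Mochizuki2012, status: disputed] -/
theorem logCondAvoid_five : logCondAvoid (ratPoint ((1 : ℚ) / 301327048)) {2, 5} = Real.log 3 + Real.log 7 + Real.log 11 + Real.log 23 + Real.log 53 := by
  have h := logCondAvoid_ratPoint_eq_sum primes exp_ne_zero den jInv_freyC (by norm_num) {2, 5} (fun p hp _ => coprime p hp)
  rw [Finset.sum_filter] at h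
  norm_num [Finset.sum_insert] at h
  linarith [h]

/-- **Level `l = 5`**: `T.Cor312PerImageOf` at every genuine Θ-datum of `1 + 3¹⁶·7 = 2³·11·23·53³` — NO hypothesis; abc-iut-c312-d1's `(1 − 1/l)`-weighted
rational test `cor312PerImageOf_ratPoint_of_le` (`LDHGenuinePerImageUnconditional`), certificate `3^3 ≤ 5^2·7·11·23`, `π > 3` (margin ≈ 8.64 nats).
[cite: Mochizuki2012, IUTchIII Cor. 3.12 p. 173–174] [claim: Mochizuki2012, status: disputed] -/
theorem cor312PerImageOf_five (T : ThetaVolumeDatumAt (ratPoint ((1 : ℚ) / 301327048)) 5) : T.Cor312PerImageOf := by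
  have hpi : Real.log 3 < Real.log Real.pi := Real.log_lt_log (by norm_num) Real.pi_gt_three
  have hp2 : 0 < Real.log 2 := Real.log_pos (by norm_num); have hp3 : 0 < Real.log 3 := Real.log_pos (by norm_num); have hp5 : 0 < Real.log 5 := Real.log_pos (by norm_num); have hp7 : 0 < Real.log 7 := Real.log_pos (by norm_num); have hp11 : 0 < Real.log 11 := Real.log_pos (by norm_num); have hp23 : 0 < Real.log 23 := Real.log_pos (by norm_num); have hp53 : 0 < Real.log 53 := Real.log_pos (by norm_num)
  refine cor312PerImageOf_ratPoint_of_le (q := (1 : ℚ) / 301327048) (by norm_num) (by norm_num) (by norm_num) (by norm_num) ?_ T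
  rw [logQAvoid_five, logCondAvoid_five]
  have hZ : (3 ^ 3 : ℕ) ≤ 5 ^ 2 * 7 * 11 * 23 := by norm_num
  have hR : ((3 : ℝ) ^ 3) ≤ (5 : ℝ) ^ 2 * (7 : ℝ) * (11 : ℝ) * (23 : ℝ) := by exact_mod_cast hZ
  have hlog := Real.log_le_log (by positivity) hR
  repeat rw [Real.log_mul (by positivity) (by positivity)] at hlog
  simp only [Real.log_pow] at hlog; push_cast at hlog ⊢; norm_num
  linarith [hlog, hpi, hp2, hp3, hp5, hp7, hp11, hp23, hp53]

/-- **EVERY PRIME LEVEL `l ≥ 5`** — the full `l`-range of the books' binders (`l.Prime → 5 ≤ l`): `T.Cor312PerImageOf` at every genuine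
Θ-datum of `1 + 3¹⁶·7 = 2³·11·23·53³`, NO hypothesis (`l = 5` here; `l ≥ 7` = `cor312PerImageOf_all`). [cite: Mochizuki2012, IUTchIII Cor. 3.12
p. 173–174] [claim: Mochizuki2012, status: disputed] -/
theorem cor312PerImageOf_every {l : ℕ} (hl : l.Prime) (h5 : 5 ≤ l)
    (T : ThetaVolumeDatumAt (ratPoint ((1 : ℚ) / 301327048)) l) : T.Cor312PerImageOf := by
  by_cases h7 : 7 ≤ l
  · exact cor312PerImageOf_all hl h7 T
  · interval_cases l
    · exact cor312PerImageOf_five T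
    · exact absurd hl (by norm_num)

end Frey301327048

/-! ### `283 + 5¹¹·13² = 2⁸·3⁸·17³`: the level `l = 5` and every prime `l ≥ 5` -/

namespace Frey283

/-- The primes of the reduced denominator of `j(λ)`. [folklore] -/
private theorem primes' : ∀ p ∈ ({2, 3, 5, 13, 17, 283} : Finset ℕ), p.Prime := by
  intro p hp
  simp only [Finset.mem_insert, Finset.mem_singleton] at hp
  rcases hp with rfl | rfl | rfl | rfl | rfl | rfl <;> norm_num

/-- The exponents are positive. [folklore] -/
private theorem exp_ne_zero' : ∀ p ∈ ({2, 3, 5, 13, 17, 283} : Finset ℕ), (fun p => if p = 2 then 8 else if p = 3 then 16 else if p = 5 then 22 else if p = 13 then 4 else if p = 17 then 6 else 2) p ≠ 0 := by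
  intro p hp
  simp only [Finset.mem_insert, Finset.mem_singleton] at hp
  rcases hp with rfl | rfl | rfl | rfl | rfl | rfl <;> norm_num

/-- The factorised denominator. [folklore] -/
private theorem den' : (1450640989446910294451489868164062500000000 : ℕ) = ∏ p ∈ ({2, 3, 5, 13, 17, 283} : Finset ℕ), p ^ (fun p => if p = 2 then 8 else if p = 3 then 16 else if p = 5 then 22 else if p = 13 then 4 else if p = 17 then 6 else 2) p := by
  rw [Finset.prod_insert (by decide), Finset.prod_insert (by decide), Finset.prod_insert (by decide), Finset.prod_insert (by decide), Finset.prod_insert (by decide), Finset.prod_singleton]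
  norm_num

/-- The numerator is prime to every prime of the denominator. [folklore] -/
private theorem coprime' : ∀ p ∈ ({2, 3, 5, 13, 17, 283} : Finset ℕ), ¬ p ∣ (315747963792470439039120932558494593237415361960848201744969 : ℕ) := by
  intro p hp
  simp only [Finset.mem_insert, Finset.mem_singleton] at hp
  rcases hp with rfl | rfl | rfl | rfl | rfl | rfl <;> norm_num

/-- `log q^{∤{2,5}}(λ)` exactly. [cite: Mochizuki2012, IUTchIV Thm 1.10 p.23] [claim: Mochizuki2012, status: disputed] -/
theorem logQAvoid_five : logQAvoid (ratPoint ((283 : ℚ) / 8251953408)) {2, 5} = 16 * Real.log 3 + 4 * Real.log 13 + 6 * Real.log 17 + 2 * Real.log 283 := by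
  have h := logQAvoid_ratPoint_eq_sum primes' exp_ne_zero' den' jInv_freyE (by norm_num) {2, 5} (fun p hp _ => coprime' p hp)
  rw [Finset.sum_filter] at h
  norm_num [Finset.sum_insert] at h
  linarith [h]

/-- `log 𝔣^{∤{2,5}}(λ)` exactly. [cite: Mochizuki2012, IUTchIV Thm 1.10 p.23] [claim: Mochizuki2012, status: disputed] -/
theorem logCondAvoid_five : logCondAvoid (ratPoint ((283 : ℚ) / 8251953408)) {2, 5} = Real.log 3 + Real.log 13 + Real.log 17 + Real.log 283 := by
  have h := logCondAvoid_ratPoint_eq_sum primes' exp_ne_zero' den' jInv_freyE (by norm_num) {2, 5} (fun p hp _ => coprime' p hp)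
  rw [Finset.sum_filter] at h
  norm_num [Finset.sum_insert] at h
  linarith [h]

/-- **Level `l = 5`**: `T.Cor312PerImageOf` at every genuine Θ-datum of `283 + 5¹¹·13² = 2⁸·3⁸·17³` — NO hypothesis; abc-iut-c312-d1's `(1 − 1/l)`-weighted
rational test `cor312PerImageOf_ratPoint_of_le` (`LDHGenuinePerImageUnconditional`), termwise (`π > 3`, `log p > 0`) (margin ≈ 10.82 nats).
[cite: Mochizuki2012, IUTchIII Cor. 3.12 p. 173–174] [claim: Mochizuki2012, status: disputed] -/
theorem cor312PerImageOf_five (T : ThetaVolumeDatumAt (ratPoint ((283 : ℚ) / 8251953408)) 5) : T.Cor312PerImageOf := by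
  have hpi : Real.log 3 < Real.log Real.pi := Real.log_lt_log (by norm_num) Real.pi_gt_three
  have hp2 : 0 < Real.log 2 := Real.log_pos (by norm_num); have hp3 : 0 < Real.log 3 := Real.log_pos (by norm_num); have hp5 : 0 < Real.log 5 := Real.log_pos (by norm_num); have hp13 : 0 < Real.log 13 := Real.log_pos (by norm_num); have hp17 : 0 < Real.log 17 := Real.log_pos (by norm_num); have hp283 : 0 < Real.log 283 := Real.log_pos (by norm_num)
  refine cor312PerImageOf_ratPoint_of_le (q := (283 : ℚ) / 8251953408) (by norm_num) (by norm_num) (by norm_num) (by norm_num) ?_ T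
  rw [logQAvoid_five, logCondAvoid_five]
  norm_num
  linarith [hpi, hp2, hp3, hp5, hp13, hp17, hp283]

/-- **EVERY PRIME LEVEL `l ≥ 5`** — the full `l`-range of the books' binders (`l.Prime → 5 ≤ l`): `T.Cor312PerImageOf` at every genuine
Θ-datum of `283 + 5¹¹·13² = 2⁸·3⁸·17³`, NO hypothesis (`l = 5` here; `l ≥ 7` = `cor312PerImageOf_all`). [cite: Mochizuki2012, IUTchIII Cor. 3.12
p. 173–174] [claim: Mochizuki2012, status: disputed] -/
theorem cor312PerImageOf_every {l : ℕ} (hl : l.Prime) (h5 : 5 ≤ l)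
    (T : ThetaVolumeDatumAt (ratPoint ((283 : ℚ) / 8251953408)) l) : T.Cor312PerImageOf := by
  by_cases h7 : 7 ≤ l
  · exact cor312PerImageOf_all hl h7 T
  · interval_cases l
    · exact cor312PerImageOf_five T
    · exact absurd hl (by norm_num)

end Frey283

/-! ### `2 + 3¹⁰·109 = 23⁵`: the level `l = 5` and every prime `l ≥ 5` -/

namespace Reyssat

/-- The primes of the reduced denominator of `j(λ)`. [folklore] -/
private theorem primes' : ∀ p ∈ ({3, 23, 109} : Finset ℕ), p.Prime := by
  intro p hp
  simp only [Finset.mem_insert, Finset.mem_singleton] at hp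
  rcases hp with rfl | rfl | rfl <;> norm_num

/-- The exponents are positive. [folklore] -/
private theorem exp_ne_zero' : ∀ p ∈ ({3, 23, 109} : Finset ℕ), (fun p => if p = 3 then 20 else if p = 23 then 10 else 2) p ≠ 0 := by
  intro p hp
  simp only [Finset.mem_insert, Finset.mem_singleton] at hp
  rcases hp with rfl | rfl | rfl <;> norm_num

/-- The factorised denominator. [folklore] -/
private theorem den' : (1716154764793810191403767369 : ℕ) = ∏ p ∈ ({3, 23, 109} : Finset ℕ), p ^ (fun p => if p = 3 then 20 else if p = 23 then 10 else 2) p := by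
  rw [Finset.prod_insert (by decide), Finset.prod_insert (by decide), Finset.prod_singleton]
  norm_num

/-- The numerator is prime to every prime of the denominator. [folklore] -/
private theorem coprime' : ∀ p ∈ ({3, 23, 109} : Finset ℕ), ¬ p ∣ (4550034081061575630856781958829776704708032 : ℕ) := by
  intro p hp
  simp only [Finset.mem_insert, Finset.mem_singleton] at hp
  rcases hp with rfl | rfl | rfl <;> norm_num

/-- `log q^{∤{2,5}}(λ)` exactly. [cite: Mochizuki2012, IUTchIV Thm 1.10 p.23] [claim: Mochizuki2012, status: disputed] -/
theorem logQAvoid_five : logQAvoid (ratPoint ((2 : ℚ) / 6436343)) {2, 5} = 20 * Real.log 3 + 10 * Real.log 23 + 2 * Real.log 109 := by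
  have h := logQAvoid_ratPoint_eq_sum primes' exp_ne_zero' den' jInv_reyssat (by norm_num) {2, 5} (fun p hp _ => coprime' p hp)
  rw [Finset.sum_filter] at h
  norm_num [Finset.sum_insert] at h
  linarith [h]

/-- `log 𝔣^{∤{2,5}}(λ)` exactly. [cite: Mochizuki2012, IUTchIV Thm 1.10 p.23] [claim: Mochizuki2012, status: disputed] -/
theorem logCondAvoid_five : logCondAvoid (ratPoint ((2 : ℚ) / 6436343)) {2, 5} = Real.log 3 + Real.log 23 + Real.log 109 := by
  have h := logCondAvoid_ratPoint_eq_sum primes' exp_ne_zero' den' jInv_reyssat (by norm_num) {2, 5} (fun p hp _ => coprime' p hp)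
  rw [Finset.sum_filter] at h
  norm_num [Finset.sum_insert] at h
  linarith [h]

/-- **Level `l = 5`**: `T.Cor312PerImageOf` at every genuine Θ-datum of `2 + 3¹⁰·109 = 23⁵` — NO hypothesis; abc-iut-c312-d1's `(1 − 1/l)`-weighted
rational test `cor312PerImageOf_ratPoint_of_le` (`LDHGenuinePerImageUnconditional`), certificate `23 ≤ 3·5^2·109`, `π > 3` (margin ≈ 5.98 nats).
[cite: Mochizuki2012, IUTchIII Cor. 3.12 p. 173–174] [claim: Mochizuki2012, status: disputed] -/
theorem cor312PerImageOf_five (T : ThetaVolumeDatumAt (ratPoint ((2 : ℚ) / 6436343)) 5) : T.Cor312PerImageOf := by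
  have hpi : Real.log 3 < Real.log Real.pi := Real.log_lt_log (by norm_num) Real.pi_gt_three
  have hp2 : 0 < Real.log 2 := Real.log_pos (by norm_num); have hp3 : 0 < Real.log 3 := Real.log_pos (by norm_num); have hp5 : 0 < Real.log 5 := Real.log_pos (by norm_num); have hp23 : 0 < Real.log 23 := Real.log_pos (by norm_num); have hp109 : 0 < Real.log 109 := Real.log_pos (by norm_num)
  refine cor312PerImageOf_ratPoint_of_le (q := (2 : ℚ) / 6436343) (by norm_num) (by norm_num) (by norm_num) (by norm_num) ?_ T
  rw [logQAvoid_five, logCondAvoid_five]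
  have hZ : (23 : ℕ) ≤ 3 * 5 ^ 2 * 109 := by norm_num
  have hR : ((23 : ℝ)) ≤ (3 : ℝ) * (5 : ℝ) ^ 2 * (109 : ℝ) := by exact_mod_cast hZ
  have hlog := Real.log_le_log (by positivity) hR
  repeat rw [Real.log_mul (by positivity) (by positivity)] at hlog
  simp only [Real.log_pow] at hlog; push_cast at hlog ⊢; norm_num
  linarith [hlog, hpi, hp2, hp3, hp5, hp23, hp109]

/-- **EVERY PRIME LEVEL `l ≥ 5`** — the full `l`-range of the books' binders (`l.Prime → 5 ≤ l`): `T.Cor312PerImageOf` at every genuine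
Θ-datum of `2 + 3¹⁰·109 = 23⁵`, NO hypothesis (`l = 5` here; `l ≥ 7` = `cor312PerImageOf_all`). [cite: Mochizuki2012, IUTchIII Cor. 3.12
p. 173–174] [claim: Mochizuki2012, status: disputed] -/
theorem cor312PerImageOf_every {l : ℕ} (hl : l.Prime) (h5 : 5 ≤ l)
    (T : ThetaVolumeDatumAt (ratPoint ((2 : ℚ) / 6436343)) l) : T.Cor312PerImageOf := by
  by_cases h7 : 7 ≤ l
  · exact cor312PerImageOf_all hl h7 T
  · interval_cases l
    · exact cor312PerImageOf_five T
    · exact absurd hl (by norm_num)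

end Reyssat

end Literature.IUT.LogVolume.Cor22

end
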